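import Summits.BirchSwinnertonDyer.Rank1Residual.X9.PrintCertClaim
import Summits.BirchSwinnertonDyer.Rank1Residual.X9.PrintCertImage
import Summits.BirchSwinnertonDyer.BirchSwinnertonDyer.Theorems.PrintX9KatoEulerHalfRecord
import HarnessLib

/-!
# Leaves X9 / X10b — per-pair certificate records plugged into the OFFER-X9-KATO-EULER doors
# (companion of `X9/PrintCertSchema/Bridge/Claim/Image.lean`; doors of seat p3:
# `Theorems/PrintX9KatoEulerHalfRecord.lean`, `PrintX10bKatoLambdaMatch.lean`)

HONEST FRAMING (cell `bsd-print-x9`, D-0131 (2) print tier; partition leaves `ClassX9` and `ClassX10 ∧ ¬Surj`):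
theorems only; nothing booked; no leaf closed; tier of every conclusion = the doors' tier (LITERAL: the binder
`hfine` = F1 = `Kato2004.exists_divisibilityInputs_fineQuotient_zeta` is a typed construction fact; the other
binders `hGr hS hPR hmodP hmodL hGZK h5 h3` are PUBLISHED named facts; see HOME/OFFER-X9-KATO-EULER-v0.md).
For a record `r` with `r.check = true` (from `certified_<slice>`), ANY globally minimal elliptic `W` with
`hI : integralModelInt W = r.intCurve` and `q = r.p`, the doors' KERNEL hypotheses — good, ordinary, `E[p]`
irreducible (and for X10b: `ClassX10 W 3`, `¬Surj W 3` via the image certificate and Zywina's `j`-line facts) —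
are discharged by `X9/PrintCertBridge.lean` / `PrintCertImage.lean`; what remains per pair is DATA:
* D2 (rank-`0` unit cell): `hcert0 : ‖L_p(f,α)(0)‖ = 1` — as a datum (`bsdp_of_check_of_norm_constantCoeff_eq_one`)
  or from the record's two-engine Iwasawa CLAIM with `λ_an = 0` (`bsdp_of_check_of_claimLambda_zero`);
* D3 (rank `1`): `hcert1 : ‖[T¹]L_p(f,α)‖ = 1` + the analytic-rank claim (`…_of_norm_coeff_one_eq_one`,
  `…_of_claimLambda_one`);
* D1 (both ranks, any unit coefficient, `p ∤ #Ш_an`): the claims `r_an = rank`, `#Ш_an(W) = r.shaAn` with the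
  decidable datum `p ∤ r.shaAn`, a unit coefficient, and the Schneider certificate hypothesis in rank `1`
  (`bsdp_of_check_of_claim_of_shaAn_unit`);
* X10b (`p = 3`) twins through `X10b.bsdp_of_fine_of_norm_constantCoeff_eq_one` /
  `X10b.bsdp_rankOne_of_fine_of_norm_coeff_one_eq_one` (`bsdp_three_of_check_of_claimLambda_zero/one`).
References: [Kato2004Asterisque] Thm. 17.4; [GreenbergVatsal2000] (1)–(2); [Zywina2015] Thm. 1.2/1.4/1.5.
-/

set_option autoImplicit false

noncomputable section

open scoped Classical MatrixGroups ModularForm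

open CongruenceSubgroup WeierstrassCurve Literature.NumberTheory.EllipticCurves
  Literature.NumberTheory.EllipticCurves.ModularForms Literature.NumberTheory.EllipticCurves.Rank1Residual
  Literature.NumberTheory.EllipticCurves.Rank1Residual.Typed
  Literature.NumberTheory.EllipticCurves.Wuthrich2014
  Literature.NumberTheory.EllipticCurves.Kato2004
  Literature.NumberTheory.EllipticCurves.Rank1Residual.X11RankOneCertificates
  Summit.BirchSwinnertonDyer.BirchSwinnertonDyer.Rank1Residual
  Summit.BirchSwinnertonDyer.BirchSwinnertonDyer.Rank1Residual.IntModel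
  Summit.BirchSwinnertonDyer.BirchSwinnertonDyer.Rank1Residual.X11RankOne
  Summit.BirchSwinnertonDyer.BirchSwinnertonDyer.Theorems.Rank1ResidualX1Defs
  Summit.BirchSwinnertonDyer.Rank1Residual

namespace Summit.BirchSwinnertonDyer.Rank1Residual.X9.PrintCert

namespace Record

variable (r : Record) {W : WeierstrassCurve ℚ} [W.IsElliptic] [W.IsGloballyMinimal]
  (hI : integralModelInt W = r.intCurve)
include hI

/-! ### X9 (`p ≥ 5`): the image-free doors D2 / D3 / D1 of `PrintX9KatoEulerHalfRecord` on a certified record -/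

/-- **D2 on a certified record (datum form)**: rank-`0` UNIT cell — `BSDp W p` from F1, the published binders,
the record's kernel-checked good-ordinary / irreducible data, and ONE datum `‖L_p(f,α)(0)‖ = 1`.
[cite: Kato2004Asterisque, Thm. 17.4 (p. 273)] [cite: GreenbergVatsal2000, p. 2–3, (2)] -/
theorem bsdp_of_check_of_norm_constantCoeff_eq_one (hc : r.check = true) {q : ℕ} [Fact q.Prime]
    (hq : q = r.p) (hp5 : 5 ≤ q) (hfine : exists_divisibilityInputs_fineQuotient_zeta)
    (hGr : greenberg_charValue_rankZero) (hmodP : nonempty_modularParametrizationData)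
    (hGZK : rank_eq_analyticRank_of_analyticRank_le_one) (h5 : realPeriodRat_eq_unit_mul_plusPeriod)
    (hcert0 : ∀ [NeZero (W.conductorNorm ℤ)] (f : CuspForm (Gamma0 (W.conductorNorm ℤ)) 2),
      IsNewformOf W f → ‖PowerSeries.coeff 0 (padicLFunction f (unitRoot W q : ℚ_[q]))‖ = 1) :
    BSDp W q :=
  IrrOrd.bsdp_of_fine_of_norm_constantCoeff_eq_one W q hfine hGr hmodP hGZK h5 hp5 (r.good_of_check hI hc hq)
    (r.goodOrd_of_check hI hc hq).2 (r.irr_of_check hI hc hq) hcert0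

/-- **D2 on a certified record (claim form)**: the datum read from the record's two-engine Iwasawa CLAIM
with `λ_an = 0` (`ClaimLambdaAt.norm_coeff_zero_eq_one`, period unit `h5`/`h3`). [cite: GreenbergVatsal2000, p. 2–3, (2)] -/
theorem bsdp_of_check_of_claimLambda_zero (hc : r.check = true) {q : ℕ} [Fact q.Prime] (hq : q = r.p)
    (hp5 : 5 ≤ q) (hfine : exists_divisibilityInputs_fineQuotient_zeta) (hGr : greenberg_charValue_rankZero)
    (hmodP : nonempty_modularParametrizationData) (hGZK : rank_eq_analyticRank_of_analyticRank_le_one)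
    (h5 : realPeriodRat_eq_unit_mul_plusPeriod) (h3 : realPeriodRat_eq_unit_mul_plusPeriod_three)
    (hl : r.lambdaAn = 0) (hL : r.ClaimLambdaAt W q) : BSDp W q :=
  have hq2 : q ≠ 2 := by omega
  r.bsdp_of_check_of_norm_constantCoeff_eq_one hI hc hq hp5 hfine hGr hmodP hGZK h5 fun f hf ↦
    hL.norm_coeff_zero_eq_one hl h5 h3 hq2 (r.good_of_check hI hc hq) (r.irr_of_check hI hc hq) f hf

/-- **D3 on a certified record (datum form)**: rank `1` — `BSDp W p` from F1, the published binders, the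
kernel-checked good-ordinary / irreducible data, the analytic-rank CLAIM `r_an = 1` and ONE datum
`‖[T¹]L_p(f,α)‖ = 1`. [cite: Kato2004Asterisque, Thm. 17.4 (p. 273)] [cite: GreenbergVatsal2000, p. 2–3, (2)] -/
theorem bsdp_rankOne_of_check_of_norm_coeff_one_eq_one (hc : r.check = true) {q : ℕ} [Fact q.Prime]
    (hq : q = r.p) (hp5 : 5 ≤ q) (hfine : exists_divisibilityInputs_fineQuotient_zeta)
    (hS : Schneider1985_order_charGenerator_odd) (hPR : perrinRiou_rankOne_leadingTerms_odd)
    (hmodP : nonempty_modularParametrizationData) (hGZK : rank_eq_analyticRank_of_analyticRank_le_one)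
    (h5 : realPeriodRat_eq_unit_mul_plusPeriod) (hr1 : W.analyticRank = 1)
    (hcert1 : ∀ [NeZero (W.conductorNorm ℤ)] (f : CuspForm (Gamma0 (W.conductorNorm ℤ)) 2),
      IsNewformOf W f → ‖PowerSeries.coeff 1 (padicLFunction f (unitRoot W q : ℚ_[q]))‖ = 1) :
    BSDp W q :=
  IrrOrd.bsdp_rankOne_of_fine_of_norm_coeff_one_eq_one W q hfine hS hPR hmodP hGZK h5 hp5
    (r.good_of_check hI hc hq) (r.goodOrd_of_check hI hc hq).2 (r.irr_of_check hI hc hq) hr1 hcert1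

/-- **D3 on a certified record (claim form)**: `λ_an = 1`, the Iwasawa CLAIM and the analytic-rank CLAIM
(`r.rank = 1` read in the record). [cite: GreenbergVatsal2000, p. 2–3, (2)] -/
theorem bsdp_rankOne_of_check_of_claimLambda_one (hc : r.check = true) {q : ℕ} [Fact q.Prime]
    (hq : q = r.p) (hp5 : 5 ≤ q) (hfine : exists_divisibilityInputs_fineQuotient_zeta)
    (hS : Schneider1985_order_charGenerator_odd) (hPR : perrinRiou_rankOne_leadingTerms_odd)
    (hmodP : nonempty_modularParametrizationData) (hGZK : rank_eq_analyticRank_of_analyticRank_le_one)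
    (h5 : realPeriodRat_eq_unit_mul_plusPeriod) (h3 : realPeriodRat_eq_unit_mul_plusPeriod_three)
    (hr1 : r.rank = 1) (hrank : r.ClaimRank W) (hl : r.lambdaAn = 1) (hL : r.ClaimLambdaAt W q) :
    BSDp W q :=
  have hq2 : q ≠ 2 := by omega
  r.bsdp_rankOne_of_check_of_norm_coeff_one_eq_one hI hc hq hp5 hfine hS hPR hmodP hGZK h5 (hrank.trans hr1)
    fun f hf ↦ (hL.norm_coeff_one_eq_one hl h5 h3 hq2 (r.good_of_check hI hc hq)
      (r.irr_of_check hI hc hq) f hf).1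

omit [W.IsElliptic] [W.IsGloballyMinimal] hI in
/-- The BSD-data CLAIM with the decidable datum `p ∤ r.shaAn` gives the door's `hunit`: `#Ш_an(W)` is a
rational `p`-adic unit. [cite: Miller2011LMS, §1 and Def. 1.1 (arXiv:1010.2431 p. 3)] -/
theorem shaAn_unit_of_claim [W.IsElliptic] [W.IsGloballyMinimal] (hB : r.ClaimBSDData W) {q : ℕ}
    [Fact q.Prime] (hsha : r.shaAn % q ≠ 0) : ∃ s : ℚ, Literature.NumberTheory.EllipticCurves.shaAn W = (s : ℂ) ∧ padicValRat q s = 0 := by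
  refine ⟨(r.shaAn : ℚ), by rw [hB.2.2]; push_cast; rfl, ?_⟩
  rw [padicValRat.of_nat, Nat.cast_eq_zero]
  exact padicValNat.eq_zero_of_not_dvd fun h ↦ hsha (Nat.mod_eq_zero_of_dvd h)

/-- **D1 on a certified record (claim form)**: both ranks, ANY unit coefficient (`λ_an` arbitrary, e.g. the
anomalous pairs) — `BSDp W p` from F1, the published binders, the kernel-checked data, the record's CLAIMS
(`r_an = rank ≤ 1`, `#Ш_an(W) = r.shaAn`, the Iwasawa certificate), the decidable datum `p ∤ r.shaAn`, and
the Schneider-certificate hypothesis `hSch` in rank `1`. [cite: Kato2004Asterisque, Thm. 17.4 (p. 273)] -/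
theorem bsdp_of_check_of_claim_of_shaAn_unit (hc : r.check = true) {q : ℕ} [Fact q.Prime] (hq : q = r.p)
    (hp5 : 5 ≤ q) (hfine : exists_divisibilityInputs_fineQuotient_zeta) (hGr : greenberg_charValue_rankZero)
    (hS : Schneider1985_order_charGenerator_odd) (hPR : perrinRiou_rankOne_leadingTerms_odd)
    (hmodP : nonempty_modularParametrizationData) (hmodL : hasEntireLFunction_rat)
    (hGZK : rank_eq_analyticRank_of_analyticRank_le_one) (h5 : realPeriodRat_eq_unit_mul_plusPeriod)
    (h3 : realPeriodRat_eq_unit_mul_plusPeriod_three) (hcl : r.ClaimAt W q)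
    (hSch : W.analyticRank = 1 → ∀ Dh : PAdicHeightData W q, Dh.IsCanonical → SchneiderConjecture Dh)
    (hsha : r.shaAn % q ≠ 0) : BSDp W q := by
  have hq2 : q ≠ 2 := by omega
  obtain ⟨-, hrank, hB, hL⟩ := hcl
  have hr : W.analyticRank ≤ 1 := hrank.trans_le (r.rank_le_one_shaAn_pos_of_check hc).1
  exact IrrOrd.bsdp_of_fine_of_unitCoeff_of_shaAn_unit W q hfine hGr hS hPR hmodP hmodL hGZK h5 hp5
    (r.good_of_check hI hc hq) (r.goodOrd_of_check hI hc hq).2 (r.irr_of_check hI hc hq) hr hSch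
    (fun f hf ↦ hL.exists_unit_coeff h5 h3 hq2 (r.good_of_check hI hc hq) (r.irr_of_check hI hc hq) f hf)
    (r.shaAn_unit_of_claim hB hsha)

/-! ### X10b (`p = 3`): the doors of `PrintX10bKatoLambdaMatch` on a certified record -/

/-- **X10b rank-`0` unit cell on a certified record**: `ClassX10 W 3 ∧ ¬Surj W 3` from the recheck, the image
certificate (Zywina `j`-line facts `h3s h3n h5s h5e h7`) and the analytic-rank CLAIM; the datum from the
Iwasawa CLAIM with `λ_an = 0`. [cite: Kato2004Asterisque, Thm. 17.4 (p. 273)] [cite: Zywina2015, Thm. 1.2 (second item)] -/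
theorem bsdp_three_of_check_of_claimLambda_zero (hc : r.check = true) (hp3 : r.p = 3)
    (hsome : r.imageCert.isSome = true) (h3s : zywina2015_thm12_not_surjective_three_of_j_eq_J2)
    (h3n : zywina2015_thm12_not_surjective_three_of_j_eq_J4)
    (h5s : zywina2015_thm14_not_surjective_five_of_j_eq_J4)
    (h5e : zywina2015_thm14_not_surjective_five_of_j_eq_J9)
    (h7 : zywina2015_thm15_not_surjective_seven_of_j_eq_J2)
    (hfine : exists_divisibilityInputs_fineQuotient_zeta) (hGr : greenberg_charValue_rankZero)
    (hmodP : nonempty_modularParametrizationData) (hGZK : rank_eq_analyticRank_of_analyticRank_le_one)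
    (h5 : realPeriodRat_eq_unit_mul_plusPeriod) (h3 : realPeriodRat_eq_unit_mul_plusPeriod_three)
    (hrank : r.ClaimRank W) (hl : r.lambdaAn = 0) (hL : r.ClaimLambdaAt W 3) : BSDp W 3 := by
  obtain ⟨hX, hns⟩ := r.classX10b_of_check_of_jLines hI hc hsome h3s h3n h5s h5e h7 hp3 hrank
  exact X10b.bsdp_of_fine_of_norm_constantCoeff_eq_one W 3 hfine hGr hmodP hGZK h3 hX hns fun f hf ↦
    hL.norm_coeff_zero_eq_one hl h5 h3 (by decide) (r.good_of_check hI hc hp3.symm)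
      (r.irr_of_check hI hc hp3.symm) f hf

/-- **X10b rank `1` on a certified record**: likewise with `λ_an = 1` and `r.rank = 1`.
[cite: Kato2004Asterisque, Thm. 17.4 (p. 273)] [cite: Zywina2015, Thm. 1.2 (second item)] -/
theorem bsdp_three_rankOne_of_check_of_claimLambda_one (hc : r.check = true) (hp3 : r.p = 3)
    (hsome : r.imageCert.isSome = true) (h3s : zywina2015_thm12_not_surjective_three_of_j_eq_J2)
    (h3n : zywina2015_thm12_not_surjective_three_of_j_eq_J4)
    (h5s : zywina2015_thm14_not_surjective_five_of_j_eq_J4)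
    (h5e : zywina2015_thm14_not_surjective_five_of_j_eq_J9)
    (h7 : zywina2015_thm15_not_surjective_seven_of_j_eq_J2)
    (hfine : exists_divisibilityInputs_fineQuotient_zeta) (hS : Schneider1985_order_charGenerator_odd)
    (hPR : perrinRiou_rankOne_leadingTerms_odd) (hmodP : nonempty_modularParametrizationData)
    (hGZK : rank_eq_analyticRank_of_analyticRank_le_one) (h5 : realPeriodRat_eq_unit_mul_plusPeriod)
    (h3 : realPeriodRat_eq_unit_mul_plusPeriod_three) (hr1 : r.rank = 1) (hrank : r.ClaimRank W)
    (hl : r.lambdaAn = 1) (hL : r.ClaimLambdaAt W 3) : BSDp W 3 := by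
  obtain ⟨hX, hns⟩ := r.classX10b_of_check_of_jLines hI hc hsome h3s h3n h5s h5e h7 hp3 hrank
  exact X10b.bsdp_rankOne_of_fine_of_norm_coeff_one_eq_one W 3 hfine hS hPR hmodP hGZK h3 hX hns
    (hrank.trans hr1) fun f hf ↦ (hL.norm_coeff_one_eq_one hl h5 h3 (by decide)
      (r.good_of_check hI hc hp3.symm) (r.irr_of_check hI hc hp3.symm) f hf).1

end Record

end Summit.BirchSwinnertonDyer.Rank1Residual.X9.PrintCert

end
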